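import Summits.AtomisticToContinuum.HydrodynamicLimit.Theorems.AntiMazurCoboundariesKineticFluxLdDecayHTheoremReduction
import Summits.AtomisticToContinuum.HydrodynamicLimit.Theorems.AntiMazurCoboundariesKineticFluxLdDecayGainDomination
import Summits.AtomisticToContinuum.HydrodynamicLimit.Theorems.AntiMazurCoboundariesKineticFluxLdDecayHTheoremObjectsE
import Summits.AtomisticToContinuum.HydrodynamicLimit.Theorems.AntiMazurCoboundariesKineticFluxLdDecayFirstMomentBudget
import Summits.AtomisticToContinuum.HydrodynamicLimit.Theorems.AntiMazurCoboundariesKineticFluxLdDecayCutProductionLeMoment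
import Summits.AtomisticToContinuum.HydrodynamicLimit.Theorems.AntiMazurCoboundariesKineticFluxLdDecayHTheoremBoundedWindows
import Summits.AtomisticToContinuum.HydrodynamicLimit.Theorems.AntiMazurCoboundariesKineticFluxLdDecayVanishingReduction
import Summits.AtomisticToContinuum.HydrodynamicLimit.Theorems.AntiMazurCoboundariesKineticFluxLdDecayTiltEntropyOfCrux
import Summits.AtomisticToContinuum.HydrodynamicLimit.Theorems.AntiMazurCoboundariesKineticFluxLdDecaySecondMomentBudget
import Summits.AtomisticToContinuum.HydrodynamicLimit.Theorems.AntiMazurCoboundariesKineticFluxLdDecayVanishingOfTiltEntropy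
import Summits.AtomisticToContinuum.HydrodynamicLimit.Theorems.AntiMazurCoboundariesKineticFluxLdDecayProductionContinuity
import Summits.AtomisticToContinuum.HydrodynamicLimit.Theorems.AntiMazurCoboundariesKineticFluxLdDecayHTheoremNormalForms
import HarnessLib

/-!
# Skeleton — crux `KineticFluxLdDecay` (stmt-AtomisticToContinuum-10967), line `h-theorem-dissipation-budget`
# (payload slug `IdeatorFourSketch`; idea card `Cruxes/KineticFluxLdDecay/Ideas/h-theorem-dissipation-budget.md`)

Lead `prover-line-stmt-AtomisticToContinuum-10967-c5-0`, RESHAPE 4 (cycle 1 of c5), skeleton v5 — FINAL: every provable stub and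
the certificate have LANDED; the ONE remaining sorry is the core, which the landed certificate proves EQUIVALENT to the crux.

State inherited from leads a2 and c4: every provable stub of the line and the whole composition had LANDED
(`Theorems/AntiMazurCoboundariesKineticFluxLdDecayHTheorem{Objects,ObjectsB,ObjectsC,ObjectsD,WindowDuality,OneBodyMarginal,
VelocityEntropyBudget,GainDomination,GainDominationLocal,PositionTailBudget,Reduction,BoundedWindows}.lean`,
`…FirstMomentBudget.lean`, `…CutProductionLeMoment.lean`; p138419 … p152128); c4 left ONE open stub, the `A`-free
large-window core `LargeWindowDissipationTilt` (window-averaged cut production of the optimal enemy `G_N^X` decaying at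
the RATE `B/τ`).

RESHAPE 4 (this lead). The landed reduction never uses the rate (AM–GM makes the production enter linearly), so the
composition accepts the strictly weaker core

* `stub_vanishingWindowDissipationTilt : VanishingWindowDissipationTilt` — window-averaged cut production of `G_N^X`
  is `≤ η` at some window `τ(η)` for all large `N` and every flow (no rate; THE OPEN CONTENT; lead),

composed with the LANDED `stub_vanishingReduction : VanishingWindowDissipationTilt → crux ∧ crux'` (wave 1, p154786).
Wave 1 also LANDED `stub_tiltEntropyVanishing_of_crux : crux → TiltEntropyVanishing` (p154960), `stub_secondMomentBudget`
(p154799), `stub_vanishing_of_tiltEntropy : ProductionContinuity → SecondMomentBudget → TiltEntropyVanishing →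
VanishingWindowDissipationTilt` (p154673), objects part E with `stub_hTheoremObjectsE : LargeWindowDissipationTilt →
VanishingWindowDissipationTilt` (p154283), `stub_productionContinuity` (p156933; kept-fibre helper `stub_productionContinuityPrelim`,
p156311), and the certificate `stub_hTheoremNormalForms` (p157839, `Theorems/…HTheoremNormalForms.lean`):

    VanishingWindowDissipationTilt ↔ crux,   TiltEntropyVanishing ↔ crux,   crux ↔ crux',
    NoPerpetualDissipationTilt ↔ LargeWindowDissipationTilt → VanishingWindowDissipationTilt.

The weakest core this line's architecture accepts is therefore a NORMAL FORM of the crux; the rate-bearing cores of reshapes 2–3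
are the crux with a window rate. Registered stubs of THIS file (sorries ONLY here): `stub_vanishingWindowDissipationTilt`.
-/

noncomputable section

open MeasureTheory ProbabilityTheory Set Filter InformationTheory
open scoped ENNReal

namespace Summit.AtomisticToContinuum.HydrodynamicLimit.Cruxes.KineticFluxLdDecay.HTheoremLine

open Literature.MathematicalPhysics.KineticTheory (T3 V3 hsDiameter localGibbsLaw)
open Literature.Analysis.FluidPDE (HardSphereFlow Config)
open Summit.AtomisticToContinuum.HydrodynamicLimit.Theorems.HTheorem

/-! ## Registered stubs -/

/-- STUB (THE CORE; lead): small window-averaged cut dissipation of the crux's optimal enemy `G_N^X` at some long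
kinetic window, uniformly in `N` at fixed `σ`. By the landed certificate (`vanishingWindowDissipationTilt_iff_crux`,
p157839) it is EQUIVALENT to the crux: N-uniform kinetic-time decorrelation of deterministic hard spheres at fixed reduced
density (open; barrier `BoltzmannHypothesisBarrierNarrow`, absence-of-proof form). -/
theorem stub_vanishingWindowDissipationTilt : VanishingWindowDissipationTilt := by
  sorry

/-! ## Certificate (LANDED, `Theorems/…HTheoremNormalForms.lean`): the core is a normal form of the crux -/

/-- The certificate of the line, by name from the tree: the three equivalences. -/
theorem certificate : HTheoremNormalForms := stub_hTheoremNormalForms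

/-- The core in entropy currency: the crux's Donsker–Varadhan optimiser is entropically negligible iff the core holds. -/
theorem tiltEntropyVanishing_iff_core : TiltEntropyVanishing ↔ VanishingWindowDissipationTilt :=
  tiltEntropyVanishing_iff_crux.trans vanishingWindowDissipationTilt_iff_crux.symm

/-! ## Composition -/

/-- **Composition** (route AntiMazurCoboundaries' copy of the crux, BY NAME): the landed reduction applied to the core.
The certificate, the rate-bearing predecessors and the global kinetic lemma are recorded as facts of the line. -/
theorem KineticFluxLdDecay_of :
    Summit.AtomisticToContinuum.HydrodynamicLimit.Theses.AntiMazurCoboundaries.KineticFluxLdDecay :=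
  have _hD0 : GainDomination := stub_gainDomination
  have _cert : HTheoremNormalForms := certificate
  have _ent := tiltEntropyVanishing_iff_core
  have _old₁ := vanishingWindowDissipationTilt_of_noPerpetualDissipationTilt
  have _old₂ := vanishingWindowDissipationTilt_of_largeWindowDissipationTilt
  have _prelim : ProductionContinuityPrelim := stub_productionContinuityPrelim
  (stub_vanishingReduction stub_vanishingWindowDissipationTilt).1

/-- **Composition** (route FluxGibbsianityLdDrude's copy of the crux, BY NAME; the two decls are syntactically
identical). -/
theorem KineticFluxLdDecay_of' :
    Summit.AtomisticToContinuum.HydrodynamicLimit.Theses.FluxGibbsianityLdDrude.KineticFluxLdDecay :=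
  (stub_vanishingReduction stub_vanishingWindowDissipationTilt).2

end Summit.AtomisticToContinuum.HydrodynamicLimit.Cruxes.KineticFluxLdDecay.HTheoremLine

end
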